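import Mathlib
import Summits.QuantumFields.YangMills.Theorems.FradkinShenkerFlowFiniteSusceptibilityWeakCouplingMirrorLogConvex
import HarnessLib

/-!
# Stub `stub_mirrorDomination` (K4) of line `Sketch`, crux `PencilRigidity.WeakCouplingHypercubicLimit`
# (stmt-QuantumFields-16120): a time-axis pair correlation is dominated by three mirror correlators

On the odd torus `(ℤ/(2S+1))⁴`, at every `β ≥ 0` and for every compact `G`, for local gauge-invariant observables
`A, B` of `ℤ⁴` whose links have time coordinates `|t| + 2 ≤ R` and for a lag `2R + 4 ≤ n ≤ S` (`1 ≤ S`), the connected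
time correlation `c = ⟨A · τ_{n e₀} B⟩ − ⟨A⟩⟨B⟩` (`latticeConnectedCorr r.ρ β (2S+1) A.F B.F n`) satisfies
`c² ≤ (D_A(j₁) + D_{Aᴿ}(j₁)) · D_{Bᴿ}(j₂)` for some `j₁, j₂ ∈ [n−1, S]`, with the three mirror correlators
`D_A(j) = ⟨A · τ_{j e₀}(A∘Θ)⟩ − ⟨A⟩⟨A∘Θ⟩`, `D_{Aᴿ}(j) = ⟨A∘Θ · τ_{j e₀} A⟩ − ⟨A∘Θ⟩⟨A⟩` and `D_{Bᴿ}(j₂)` all non-negative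
(`Θ = cfgReflect`, the `ℤ⁴` time reflection `t ↦ −t` with temporal links inverted; `Aᴿ = reflSpecies A = A ∘ Θ`).

Mechanism — the argument of the landed `FiniteSusceptibilityWeakCoupling.stub_mirrorDominationAxis0` with the pairs
made explicit: centred reflection positivity + Cauchy–Schwarz on the odd torus (`stub_rpCauchySchwarz stub_oddTorusRP`)
in the link plane `t = p + ½`, `p = ⌊n/2⌋` (`π = 1`, `v = p e₀`), for the positive-half observables
`F = Aᴿ∘τ_{-(2p+1)e₀}∘lift`, `G' = B∘τ_{-n e₀}∘lift` (`torusEdge_mem_pos`); `F∘Θ_p = A∘lift` (`torusLift_theta`,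
`reflSpecies_F_shift_cfgReflect_shift`) and `Cov(G'∘Θ_p, G') = D_{Bᴿ}(2n−2p−1)` (`F_shift_cfgReflect_shift`,
`cov_translate_left`), so that `c² ≤ D_A(2p+1) · D_{Bᴿ}(2n−2p−1)` with both factors `≥ 0`
(`SiblingFunnel.covariance_eq_latticeConnectedCorr`); a lag `2p + 1 = S + 1` is folded to `D_{Aᴿ}(S)`
(`MirrorLogConvex.mirrorCorr_fold`); the one remaining mirror correlator is `≥ 0` by `MirrorLogConvex.mirrorCorr_nonneg`
(radius `R + 1` for `Aᴿ`, `MirrorLogConvex.radius_reflSpecies`, `mirrorCorr_reflSpecies`).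
Reference: K. Osterwalder, E. Seiler, Ann. Phys. 110 (1978) 440, §2. [folklore]
-/

noncomputable section

open MeasureTheory ProbabilityTheory Finset
open Literature.MathematicalPhysics.QuantumFieldTheory hiding Site ZdEdge
open Literature.MathematicalPhysics.QuantumLattice
open Literature.Probability.LatticeModels hiding configShift configShift_apply
open Summit.QuantumFields.YangMills.Theorems.FiniteSusceptibilityWeakCoupling
open Summit.QuantumFields.YangMills.Theorems.FiniteSusceptibilityWeakCoupling.MirrorDominationAxis0
open Summit.QuantumFields.YangMills.Theorems.FiniteSusceptibilityWeakCoupling.MirrorLogConvex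

namespace Summit.QuantumFields.YangMills.Theorems.WeakCouplingHypercubicLimit.TraceNormColdPressure

variable {G : Type} [Group G] [TopologicalSpace G] [IsTopologicalGroup G] [CompactSpace G]
  [MeasurableSpace G] [BorelSpace G]

-- adapted from `Summit.QuantumFields.YangMills.Theorems.FiniteSusceptibilityWeakCoupling.stub_mirrorDominationAxis0`
-- (`Summits/QuantumFields/YangMills/Theorems/FradkinShenkerFlowFiniteSusceptibilityWeakCouplingMirrorDominationAxis0.lean`)
/-- **RP + Cauchy–Schwarz in the link plane `t = p + ½`, read on connected time correlators** (every compact `G`,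
`β ≥ 0`). For `A, B` of time radius `R` (`|t| + 2 ≤ R` on the supports), `2R + 4 ≤ n ≤ S`, `1 ≤ S` and
`2p ≤ n ≤ 2p + 1`: `0 ≤ D_A(2p+1)`, `0 ≤ D_{Bᴿ}(2n−2p−1)` and `⟨A; τ_n B⟩² ≤ D_A(2p+1) · D_{Bᴿ}(2n−2p−1)` on the torus
`2S+1` — `stub_rpCauchySchwarz stub_oddTorusRP` with `π = 1`, `v = p e₀`, `F = Aᴿ∘τ_{-(2p+1)e₀}∘lift`,
`G' = B∘τ_{-n e₀}∘lift`, then `torusLift_theta`, `cov_translate_left`, `SiblingFunnel.covariance_eq_latticeConnectedCorr`.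
[folklore] -/
theorem rp_linkPlane_pair (r : LatticeRep G) {β : ℝ} (hβ : 0 ≤ β) (A B : YMSpecies G) {R : ℕ}
    (hRA : ∀ e ∈ A.supp, (e.1 0).natAbs + 2 ≤ R) (hRB : ∀ e ∈ B.supp, (e.1 0).natAbs + 2 ≤ R)
    {S n p : ℕ} (hS : 1 ≤ S) (hn : 2 * R + 4 ≤ n) (hnS : n ≤ S) (hpn : 2 * p ≤ n) (hnp : n ≤ 2 * p + 1) :
    0 ≤ latticeConnectedCorr r.ρ β (2 * S + 1) A.F (fun V => A.F (cfgReflect V)) (2 * p + 1) ∧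
    0 ≤ latticeConnectedCorr r.ρ β (2 * S + 1) (fun V => B.F (cfgReflect V)) B.F (2 * n - 2 * p - 1) ∧
    latticeConnectedCorr r.ρ β (2 * S + 1) A.F B.F n ^ 2 ≤
      latticeConnectedCorr r.ρ β (2 * S + 1) A.F (fun V => A.F (cfgReflect V)) (2 * p + 1) *
        latticeConnectedCorr r.ρ β (2 * S + 1) (fun V => B.F (cfgReflect V)) B.F (2 * n - 2 * p - 1) := by
  haveI : IsProbabilityMeasure (wilsonMeasure (d := 4) (L := 2 * S + 1) r.ρ β) :=
    isProbabilityMeasure_wilsonMeasure _ r.continuous β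
  -- RP + Cauchy–Schwarz in the plane `(1, p e₀)` for `F = Aᴿ∘τ_{-(2p+1)e₀}∘lift`, `G' = B∘τ_{-n e₀}∘lift`
  obtain ⟨hD₁, hD₂, hcs⟩ := stub_rpCauchySchwarz stub_oddTorusRP G r.N r.ρ r.continuous β hβ S hS 1
    (Torus.proj (2 * S + 1) (Pi.single 0 (p : ℤ)))
    (fun U => (reflSpecies A).F
      (configShift (-(Pi.single 0 ((2 * p + 1 : ℕ) : ℤ))) (torusLift (2 * S + 1) U)))
    (fun U => B.F (configShift (-(Pi.single 0 (n : ℤ))) (torusLift (2 * S + 1) U)))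
    ((reflSpecies A).measurable.comp ((configShift _).measurable.comp (measurable_torusLift _)))
    (B.measurable.comp ((configShift _).measurable.comp (measurable_torusLift _)))
    (by obtain ⟨C, hC⟩ := (reflSpecies A).bounded; exact ⟨C, fun U => hC _⟩)
    (by obtain ⟨C, hC⟩ := B.bounded; exact ⟨C, fun U => hC _⟩)
    (by
      refine (Negative.dependsOn_comp_configShift_torusLift (2 * S + 1) (reflSpecies A) _).mono ?_
      intro e he
      obtain ⟨e', he', rfl⟩ := Finset.mem_image.1 (Finset.mem_coe.1 he)
      obtain ⟨e'', he'', rfl⟩ := Finset.mem_image.1 he'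
      have ht := hRA e'' he''
      have h0 : ((reflectEdge e'').1 + (Pi.single 0 ((2 * p + 1 : ℕ) : ℤ) : Site 4)) 0 =
          (if e''.2 = 0 then -e''.1 0 - 1 else -e''.1 0) + (2 * p + 1 : ℕ) := by
        rw [Pi.add_apply, reflectEdge_fst_zero, Pi.single_eq_same]
      refine torusEdge_mem_pos S p _ _ ?_ ?_ <;> rw [h0] <;> split_ifs <;> omega)
    (by
      refine (Negative.dependsOn_comp_configShift_torusLift (2 * S + 1) B (Pi.single 0 (n : ℤ))).mono ?_
      intro e he
      obtain ⟨e', he', rfl⟩ := Finset.mem_image.1 (Finset.mem_coe.1 he)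
      have ht := hRB e' he'
      have h0 : (e'.1 + (Pi.single 0 (n : ℤ) : Site 4)) 0 = e'.1 0 + n := by
        rw [Pi.add_apply, Pi.single_eq_same]
      refine torusEdge_mem_pos S p _ _ ?_ ?_ <;> rw [h0] <;> omega)
  -- `F∘Θ_p = A∘lift`, `G'∘Θ_p = Bᴿ∘τ_{-(θ(n e₀)+(2p+1)e₀)}∘lift`, and `Cov(G'∘Θ_p, G') = D_{Bᴿ}(2n-2p-1)`
  simp only [torusLift_theta, reflSpecies_F_shift_cfgReflect_shift] at hD₁ hD₂ hcs
  simp only [F_shift_cfgReflect_shift] at hD₂ hcs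
  have hvec : -(Pi.single 0 (n : ℤ) : Site 4) +
      (siteReflect (Pi.single 0 (n : ℤ)) + Pi.single 0 ((2 * p + 1 : ℕ) : ℤ)) =
      -(Pi.single 0 ((2 * n - 2 * p - 1 : ℕ) : ℤ)) := by
    funext k; by_cases hk : k = 0 <;> simp [siteReflect_apply, hk]
    omega
  rw [cov_translate_left r.ρ β (reflSpecies B).F B.F hvec] at hD₂ hcs
  -- covariances of lifted observables are the connected time correlators
  rw [SiblingFunnel.covariance_eq_latticeConnectedCorr r β A (reflSpecies A) S] at hD₁
  rw [SiblingFunnel.covariance_eq_latticeConnectedCorr r β (reflSpecies B) B S] at hD₂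
  rw [SiblingFunnel.covariance_eq_latticeConnectedCorr r β A B S,
    SiblingFunnel.covariance_eq_latticeConnectedCorr r β A (reflSpecies A) S,
    SiblingFunnel.covariance_eq_latticeConnectedCorr r β (reflSpecies B) B S] at hcs
  exact ⟨hD₁, hD₂, hcs⟩

/-- `stub_mirrorDomination` (K4, registered on stmt-QuantumFields-16120) — **a general time-axis pair correlation is
dominated by three mirror correlators** (every compact `G`, `β ≥ 0`): for local gauge-invariant `A, B` of time radius
`R` and a lag `2R + 4 ≤ n ≤ S` on the torus `2S+1` there are `j₁, j₂ ∈ [n−1, S]` with `0 ≤ D_A(j₁)`, `0 ≤ D_{Aᴿ}(j₁)`,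
`0 ≤ D_{Bᴿ}(j₂)` and `⟨A; τ_n B⟩² ≤ (D_A(j₁) + D_{Aᴿ}(j₁)) · D_{Bᴿ}(j₂)`: `rp_linkPlane_pair` with `p = ⌊n/2⌋` gives
`⟨A; τ_n B⟩² ≤ D_A(2p+1) · D_{Bᴿ}(2n−2p−1)`; if `2p + 1 ≤ S` take `j₁ = 2p+1` (`0 ≤ D_{Aᴿ}(2p+1)` by `mirrorCorr_nonneg` for
`Aᴿ`, radius `R+1`), else `n = S = 2p` and the lag `S + 1` folds to `D_{Aᴿ}(S)` (`mirrorCorr_fold`), `j₁ = S`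
(`0 ≤ D_A(S)` by `mirrorCorr_nonneg`); always `j₂ = 2n − 2p − 1`. [folklore] -/
theorem stub_mirrorDomination :
    ∀ (G : Type) [Group G] [TopologicalSpace G] [IsTopologicalGroup G] [CompactSpace G]
      [MeasurableSpace G] [BorelSpace G] (r : LatticeRep G) (β : ℝ), 0 ≤ β →
      ∀ (A B : YMSpecies G) (R : ℕ), (∀ e ∈ A.supp, (e.1 0).natAbs + 2 ≤ R) → (∀ e ∈ B.supp, (e.1 0).natAbs + 2 ≤ R) →
      ∀ (S n : ℕ), 1 ≤ S → 2 * R + 4 ≤ n → n ≤ S →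
        ∃ j₁ j₂ : ℕ, n ≤ j₁ + 1 ∧ j₁ ≤ S ∧ n ≤ j₂ + 1 ∧ j₂ ≤ S ∧
          0 ≤ latticeConnectedCorr r.ρ β (2 * S + 1) A.F (fun V => A.F (cfgReflect V)) j₁ ∧
          0 ≤ latticeConnectedCorr r.ρ β (2 * S + 1) (fun V => A.F (cfgReflect V)) A.F j₁ ∧
          0 ≤ latticeConnectedCorr r.ρ β (2 * S + 1) (fun V => B.F (cfgReflect V)) B.F j₂ ∧
          latticeConnectedCorr r.ρ β (2 * S + 1) A.F B.F n ^ 2 ≤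
            (latticeConnectedCorr r.ρ β (2 * S + 1) A.F (fun V => A.F (cfgReflect V)) j₁ +
                latticeConnectedCorr r.ρ β (2 * S + 1) (fun V => A.F (cfgReflect V)) A.F j₁) *
              latticeConnectedCorr r.ρ β (2 * S + 1) (fun V => B.F (cfgReflect V)) B.F j₂ := by
  intro G _ _ _ _ _ _ r β hβ A B R hRA hRB S n hS hn hnS
  -- the link plane `t = p + ½`, `p = ⌊n/2⌋`
  obtain ⟨p, hp⟩ : ∃ p : ℕ, p = n / 2 := ⟨_, rfl⟩
  obtain ⟨h₁, h₂, hcs⟩ := rp_linkPlane_pair r hβ A B hRA hRB (S := S) (n := n) (p := p) hS hn hnS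
    (by omega) (by omega)
  -- the mirror species `Aᴿ` has time radius `R + 1`
  have hRA' : ∀ e ∈ (reflSpecies A).supp, (e.1 0).natAbs + 2 ≤ R + 1 :=
    radius_reflSpecies A (k := 2) fun e he => by have := hRA e he; omega
  by_cases hfold : 2 * p + 1 ≤ S
  · -- no fold: `j₁ = 2p + 1`, `j₂ = 2n - 2p - 1`
    have h₃ : 0 ≤ latticeConnectedCorr r.ρ β (2 * S + 1) (fun V => A.F (cfgReflect V)) A.F (2 * p + 1) := by
      rw [← mirrorCorr_reflSpecies r β A S (2 * p + 1)]
      exact mirrorCorr_nonneg r hβ (reflSpecies A) hRA' (by omega) (by omega)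
    refine ⟨2 * p + 1, 2 * n - 2 * p - 1, by omega, hfold, by omega, by omega, h₁, h₃, h₂, ?_⟩
    exact hcs.trans (mul_le_mul_of_nonneg_right (le_add_of_nonneg_right h₃) h₂)
  · -- `n = S = 2p`: the lag `2p + 1 = S + 1` folds to the pair `(Aᴿ, A)` at lag `S`; `j₁ = S`, `j₂ = S - 1`
    rw [mirrorCorr_fold r β A (show 2 * p + 1 ≤ 2 * S + 1 by omega),
      show 2 * S + 1 - (2 * p + 1) = S by omega] at h₁ hcs
    have h₃ : 0 ≤ latticeConnectedCorr r.ρ β (2 * S + 1) A.F (fun V => A.F (cfgReflect V)) S :=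
      mirrorCorr_nonneg r hβ A hRA (by omega) (by omega)
    refine ⟨S, 2 * n - 2 * p - 1, by omega, le_rfl, by omega, by omega, h₃, h₁, h₂, ?_⟩
    exact hcs.trans (mul_le_mul_of_nonneg_right (le_add_of_nonneg_left h₃) h₂)

end Summit.QuantumFields.YangMills.Theorems.WeakCouplingHypercubicLimit.TraceNormColdPressure

end
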